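import Summits.Ventures.AbcSig.Rows.TemplateAB2
import Summits.Ventures.AbcSig.Rows.XTemplateAB

/-!
# Venture AbcSig — EXTENDED-EXCLUSION twin of `Rows/TemplateAB2.lean` (GENERATED by gen/mkxtemplates.py)

HONEST FRAMING. Template file of a COMPUTATION cell (`pub-abcsig`); no claim on ABC or any summit. Each theorem
`x<name>` below is the theorem `<name>` of `Rows/TemplateAB2.lean` with ONE change: the per-orbit alternative of every level
hypothesis reads `o.Eliminated bs04Allowed n ∨ (M.Excludes N o fam ∨ M.ExcludesStd N o n)` instead of
`o.Eliminated bs04Allowed n ∨ M.Excludes N o fam`, where `M.ExcludesStd N o n` (`Recipes/EisPackage.lean`) says that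
no STANDING datum with exponent `n` has its mod-`n` representation arising from a newform matching `o` — the shape
in which the cell's module-M6 (Eisenstein congruence) certificates are discharged by the kernel
(`NewformModel.excludesStd_of_m6`, given the cited `EisPackage` and the computed `Refines`). Proofs are the originals
verbatim up to the renamed callee; the final step is `xno_solution_in_case`.
-/

namespace Summit.Ventures.AbcSig



/-- Distribution `(ℓ^m, 2^a)`, **class `a = 2`** (levels `4ℓ` and `8ℓ` for `y` odd, `2ℓ` for `y` even). -/
theorem xrowC2aAB_a2 (ℓ : ℕ) (hℓ : ℓ.Prime) (hℓ2 : ℓ ≠ 2) (M : NewformModel) (hP : M.BS04Package)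
    (n : ℕ) (hn : n.Prime) (h7 : 7 ≤ n) (hnℓ : n ≠ ℓ) {orbs4 orbs8 orbs2 : List OrbitData}
    (hD4 : M.DataComplete (4 * ℓ) orbs4) (hD8 : M.DataComplete (8 * ℓ) orbs8) (hD2 : M.DataComplete (2 * ℓ) orbs2)
    (m : ℕ) (hm : 1 ≤ m) (hmn : m < n)
    (hS4 : ∀ o ∈ orbs4, (∀ e ∈ o.coeffs, e.ell.Prime ∧ e.ell ≠ 2 ∧ ¬ e.ell ∣ 4 * ℓ) ∧
      (o.Eliminated bs04Allowed n ∨ (M.Excludes (4 * ℓ) o (famAB (ℓ ^ m) (2 ^ 2) n (fun _ _ => True)) ∨ M.ExcludesStd (4 * ℓ) o n)))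
    (hS8 : ∀ o ∈ orbs8, (∀ e ∈ o.coeffs, e.ell.Prime ∧ e.ell ≠ 2 ∧ ¬ e.ell ∣ 8 * ℓ) ∧
      (o.Eliminated bs04Allowed n ∨ (M.Excludes (8 * ℓ) o (famAB (ℓ ^ m) (2 ^ 2) n (fun _ _ => True)) ∨ M.ExcludesStd (8 * ℓ) o n)))
    (hS2 : ∀ o ∈ orbs2, (∀ e ∈ o.coeffs, e.ell.Prime ∧ e.ell ≠ 2 ∧ ¬ e.ell ∣ 2 * ℓ) ∧
      (o.Eliminated bs04Allowed n ∨ (M.Excludes (2 * ℓ) o (famAB (ℓ ^ m) (2 ^ 2) n (fun _ _ => True)) ∨ M.ExcludesStd (2 * ℓ) o n)))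
    (x y z : ℤ) (hxy1 : x * y ≠ 1) (hxy2 : x * y ≠ -1) : ¬ IsPrimitiveSolution (ℓ ^ m) (2 ^ 2) 1 n x y z := by
  intro hsol
  by_cases hy : 2 ∣ y
  · exact xrowC2aAB_yeven ℓ hℓ hℓ2 M hP n hn h7 hnℓ hD2 2 m hm (by omega) hmn hS2 x y z hy hxy1 hxy2 hsol
  obtain ⟨hA, hB, hnAB, hfree⟩ := sideAB ℓ 2 m n hℓ hℓ2 hn (by omega) hnℓ (by omega) hmn
  obtain ⟨-, -, -, -, hL4, hL8, -⟩ := levelsC2aAB ℓ hℓ hℓ2 n hnℓ 2 m hm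
  have hBeven : 2 ∣ ((2 ^ 2 : ℕ) : ℤ) := by norm_num
  have hx := odd_x_of_even_B' hsol hBeven
  have hxy : ¬ 2 ∣ x * y := not_two_dvd_mul hx hy
  have hB2 : OrdTwoEq ((2 ^ 2 : ℕ) : ℤ) 2 := by
    have : ((2 ^ 2 : ℕ) : ℤ) = 2 ^ 2 * 1 := by norm_num
    rw [this]; exact ordTwoEq_twoPow_mul_odd 2 1 (by omega)
  exact xbranchAB_iii _ _ hA hB M hP n hn h7 hnAB hfree (4 * ℓ) (8 * ℓ) hL4 hL8 (fun _ _ => True) hD4 hD8 hS4 hS8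
    x y z trivial hB2 hxy hxy1 hxy2 hsol

/-- Distribution `(ℓ^m, 2^a)`, **class `a = 1`** (level `128ℓ` for `y` odd, `2ℓ` for `y` even). -/
theorem xrowC2aAB_a1 (ℓ : ℕ) (hℓ : ℓ.Prime) (hℓ2 : ℓ ≠ 2) (M : NewformModel) (hP : M.BS04Package)
    (n : ℕ) (hn : n.Prime) (h7 : 7 ≤ n) (hnℓ : n ≠ ℓ) {orbs128 orbs2 : List OrbitData}
    (hD128 : M.DataComplete (128 * ℓ) orbs128) (hD2 : M.DataComplete (2 * ℓ) orbs2) (m : ℕ) (hm : 1 ≤ m) (hmn : m < n)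
    (hS128 : ∀ o ∈ orbs128, (∀ e ∈ o.coeffs, e.ell.Prime ∧ e.ell ≠ 2 ∧ ¬ e.ell ∣ 128 * ℓ) ∧
      (o.Eliminated bs04Allowed n ∨ (M.Excludes (128 * ℓ) o (famAB (ℓ ^ m) (2 ^ 1) n (fun _ _ => True)) ∨ M.ExcludesStd (128 * ℓ) o n)))
    (hS2 : ∀ o ∈ orbs2, (∀ e ∈ o.coeffs, e.ell.Prime ∧ e.ell ≠ 2 ∧ ¬ e.ell ∣ 2 * ℓ) ∧
      (o.Eliminated bs04Allowed n ∨ (M.Excludes (2 * ℓ) o (famAB (ℓ ^ m) (2 ^ 1) n (fun _ _ => True)) ∨ M.ExcludesStd (2 * ℓ) o n)))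
    (x y z : ℤ) (hxy1 : x * y ≠ 1) (hxy2 : x * y ≠ -1) : ¬ IsPrimitiveSolution (ℓ ^ m) (2 ^ 1) 1 n x y z := by
  intro hsol
  by_cases hy : 2 ∣ y
  · exact xrowC2aAB_yeven ℓ hℓ hℓ2 M hP n hn h7 hnℓ hD2 1 m hm (by omega) hmn hS2 x y z hy hxy1 hxy2 hsol
  obtain ⟨hA, hB, hnAB, hfree⟩ := sideAB ℓ 1 m n hℓ hℓ2 hn (by omega) hnℓ (by omega) hmn
  obtain ⟨-, -, -, -, -, -, hL128⟩ := levelsC2aAB ℓ hℓ hℓ2 n hnℓ 1 m hm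
  have hBeven : 2 ∣ ((2 ^ 1 : ℕ) : ℤ) := by norm_num
  have hx := odd_x_of_even_B' hsol hBeven
  have hxy : ¬ 2 ∣ x * y := not_two_dvd_mul hx hy
  have hB1 : OrdTwoEq ((2 ^ 1 : ℕ) : ℤ) 1 := by
    have : ((2 ^ 1 : ℕ) : ℤ) = 2 ^ 1 * 1 := by norm_num
    rw [this]; exact ordTwoEq_twoPow_mul_odd 1 1 (by omega)
  exact xbranchAB_iiB _ _ hA hB M hP n hn h7 hnAB hfree (128 * ℓ) hL128 (fun _ _ => True) hD128 hS128 x y z trivial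
    hB1 hxy hxy1 hxy2 hsol

end Summit.Ventures.AbcSig
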